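import Literature.Geometry.Riemannian.MetricFlowSliceMassDistribution
import Literature.Geometry.Riemannian.MVbCompact
import HarnessLib

/-!
# Time-slices of `H`-concentrated metric flows lie in the compact spaces `𝕄_r(V, b)`
# (Bamler 2023, §4.1, Proposition, "in particular")

R. Bamler, *Compactness theory of the space of super Ricci flows*, Invent. Math. 233 (2023), §4.1,
Proposition, second part: *"In particular, if there is a sequence `τᵢ ↘ 0` with `t + τᵢ r² ∈ I'`,
then there is a function `b_{H,V,(τᵢ)} : (0, 1) → (0, 1)`, depending only on `H, V, (τᵢ)`, such
that `b^{(𝒳_t, d_t, μ_t)}_r ≥ b_{H,V,(τᵢ)}` and therefore `(𝒳_t, d_t, μ_t) ∈ 𝕄(V, b_{H,V,(τᵢ)})`"*,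
and the sentence before the Proposition: *"So we obtain that these time-slices represent classes
in certain spaces of the form `𝕄_r(V, b)`, which are compact by Theorem 2.23."* We take the
available future times to be a whole interval of parameters `τ ∈ (0, θ]` (the case of Ricci flows
and of conjugate heat kernels `ν_{x;·}` away from the final time) and make the function explicit:
`τ(ε) := min(θ, ε³/(8 max(H, 1)))`, `b_{H,V,θ}(ε) := ½ Φ(−√(8V/(ε τ(ε))))`.

* `sliceMassBound H V θ` — **the function `b_{H,V,θ}`**, with `0 < b_{H,V,θ} ≤ 1` on `(0, 1]`;
* `IsHConcentrated.isMVb_slice` — **`(𝒳_t, d_t, μ_t) ∈ 𝕄_r(V, b_{H,V,θ})`**;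
* `IsHConcentrated.exists_tendsto_subseq_slices` — **subsequential `d_{GW₁}`-convergence of such
  time-slices along a sequence of flows** (Theorem 2.23).

Everything is proved; the only definition is `sliceMassBound`; no named facts.

## References

* R. H. Bamler, *Compactness theory of the space of super Ricci flows*, Invent. Math. 233 (2023),
  §4.1, Proposition (mass distribution on time-slices), "in particular"; §2.5, Theorem.
  [Bamler2023]
-/

noncomputable section

open Set MeasureTheory Filter Topology Metric Function
open scoped ENNReal NNReal

namespace Literature.Geometry.Riemannian

namespace MetricFlow

universe u

/-! ### The function `b_{H,V,θ}` -/

/-- The admissible parameter `τ(ε) := min(θ, ε³ / (8 max(H, 1)))`, so that `8 τ(ε) H ≤ ε³` and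
`0 < τ(ε) ≤ θ` for `ε > 0`. [cite: Bamler2023, §4.1, Proposition (mass distribution on time-slices)] -/
def sliceTau (H θ ε : ℝ) : ℝ :=
  min θ (ε ^ 3 / (8 * max H 1))

/-- **`b_{H,V,θ}(ε) := ½ Φ(−√(8V/(ε τ(ε))))`**, a lower bound for the mass distribution functions
of time-slices at scale `r` of `H`-concentrated flows carrying a conjugate heat flow of variance
`≤ V r²` on `[t, t + θ r²]`. [cite: Bamler2023, §4.1, Proposition (mass distribution on time-slices)] -/
def sliceMassBound (H V θ : ℝ) (ε : ℝ) : ℝ≥0∞ :=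
  ENNReal.ofReal (Phi (-Real.sqrt (8 * V / (ε * sliceTau H θ ε))) / 2)

/-- `0 < τ(ε)` for `θ, ε > 0`. [cite: Bamler2023, §4.1, Proposition (mass distribution on time-slices)] -/
theorem sliceTau_pos {H θ ε : ℝ} (hθ : 0 < θ) (hε : 0 < ε) : 0 < sliceTau H θ ε :=
  lt_min hθ (by positivity)

/-- `τ(ε) ≤ θ`. [cite: Bamler2023, §4.1, Proposition (mass distribution on time-slices)] -/
theorem sliceTau_le (H θ ε : ℝ) : sliceTau H θ ε ≤ θ := min_le_left _ _

/-- `8 τ(ε) H ≤ ε³` for `ε, θ ≥ 0`. [cite: Bamler2023, §4.1, Proposition (mass distribution on time-slices)] -/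
theorem eight_mul_sliceTau_mul_le {H θ ε : ℝ} (hθ : 0 ≤ θ) (hε : 0 ≤ ε) :
    8 * (sliceTau H θ ε * H) ≤ ε ^ 3 := by
  have hmax : 0 < max H 1 := lt_max_of_lt_right zero_lt_one
  have hle : sliceTau H θ ε ≤ ε ^ 3 / (8 * max H 1) := min_le_right _ _
  have hτ0 : 0 ≤ sliceTau H θ ε := le_min hθ (by positivity)
  rcases le_or_gt H 0 with hH | hH
  · nlinarith [mul_nonpos_iff.2 (Or.inl ⟨hτ0, hH⟩), pow_nonneg hε 3]
  · calc 8 * (sliceTau H θ ε * H) ≤ 8 * (ε ^ 3 / (8 * max H 1) * H) := by gcongr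
      _ ≤ 8 * (ε ^ 3 / (8 * max H 1) * max H 1) := by gcongr; exact le_max_left _ _
      _ = ε ^ 3 := by field_simp

/-- `b_{H,V,θ}(ε) ≠ 0` (`Φ > 0`). [cite: Bamler2023, §4.1, Proposition (mass distribution on time-slices)] -/
theorem sliceMassBound_ne_zero (H V θ ε : ℝ) : sliceMassBound H V θ ε ≠ 0 := by
  unfold sliceMassBound
  exact (ENNReal.ofReal_pos.2
    (by linarith [Phi_pos (-Real.sqrt (8 * V / (ε * sliceTau H θ ε)))])).ne'

/-- `b_{H,V,θ}(ε) ≤ 1`. [cite: Bamler2023, §4.1, Proposition (mass distribution on time-slices)] -/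
theorem sliceMassBound_le_one (H V θ ε : ℝ) : sliceMassBound H V θ ε ≤ 1 := by
  unfold sliceMassBound
  exact ENNReal.ofReal_le_one.2
    (by linarith [(Phi_mem_Icc (-Real.sqrt (8 * V / (ε * sliceTau H θ ε)))).2])

/-! ### Time-slices lie in `𝕄_r(V, b_{H,V,θ})` -/

variable {I : Set ℝ} {𝒳 : MetricFlow.{u} I} {H : ℝ}

/-- **Time-slices of `H`-concentrated flows lie in `𝕄_r(V, b_{H,V,θ})`** (Bamler 2023, §4.1,
Proposition, "in particular"): if `(μ_t)_{t ∈ I'}` is a conjugate heat flow with `Var(μ_t) ≤ V r²`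
and `Var(μ_{t + τ r²}) ≤ V r²`, `t + τ r² ∈ I'` for all `τ ∈ (0, θ]`, then
`(𝒳_t, d_t, μ_t) ∈ 𝕄_r(V, b_{H,V,θ})`. [cite: Bamler2023, §4.1, Proposition (mass distribution on time-slices)] -/
theorem IsHConcentrated.isMVb_slice (hH : 𝒳.IsHConcentrated H)
    {I' : Set ℝ} {μ : ∀ t : I, Measure (𝒳.Slice t)} (hμ : 𝒳.IsConjugateHeatFlow I' μ)
    {t : I} (ht : (t : ℝ) ∈ I') {r V θ : ℝ} (hr : 0 < r) (hV0 : 0 < V) (hθ : 0 < θ)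
    (hVt : variance (μ t) (μ t) ≤ ENNReal.ofReal (V * r ^ 2))
    (hfut : ∀ τ ∈ Ioc (0 : ℝ) θ, ∃ t' : I, (t' : ℝ) = t + τ * r ^ 2 ∧ (t' : ℝ) ∈ I' ∧
      variance (μ t') (μ t') ≤ ENNReal.ofReal (V * r ^ 2)) :
    IsMVb (μ t) r V (sliceMassBound H V θ) := by
  refine ⟨hVt, fun ε hε ↦ ?_⟩
  obtain ⟨hε0, hε1⟩ := hε
  obtain ⟨t', htt', ht', hVt'⟩ :=
    hfut (sliceTau H θ ε) ⟨sliceTau_pos hθ hε0, sliceTau_le _ _ _⟩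
  exact hH.le_massDistribution_slice hμ ht ht' hr (sliceTau_pos hθ hε0) htt' hV0 hVt' hε0 hε1
    (eight_mul_sliceTau_mul_le hθ.le hε0.le)

/-- **Subsequential `d_{GW₁}`-convergence of time-slices along a sequence of flows** (Bamler
2023, §4.1, before the Proposition: *"these time-slices represent classes in certain spaces of
the form `𝕄_r(V, b)`, which are compact by Theorem 2.23"*): probability measures `μᵢ` on
time-slices `𝒳^i_{tᵢ}` of metric flows `𝒳^i` which all lie in `𝕄_r(V, b_{H,V,θ})` (e.g. by
`isMVb_slice`) have a subsequence converging in `d_{GW₁}` to a member of `𝕄_r(V, b_{H,V,θ})`.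
[cite: Bamler2023, §2.5, Theorem ((𝕄_r(V, b), d_{GW₁}) is compact)] -/
theorem exists_tendsto_subseq_of_isMVb_slices {J : ℕ → Set ℝ} (𝒴 : ∀ i, MetricFlow.{u} (J i))
    (t : ∀ i, J i) (μ : ∀ i, Measure ((𝒴 i).Slice (t i))) [∀ i, IsProbabilityMeasure (μ i)]
    {r V θ : ℝ} (hr : 0 < r) (hV0 : 0 ≤ V)
    (h : ∀ i, IsMVb (μ i) r V (sliceMassBound H V θ)) :
    ∃ φ : ℕ → ℕ, StrictMono φ ∧
      ∃ (S : Type u) (_ : MetricSpace S) (_ : MeasurableSpace S) (_ : BorelSpace S)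
        (_ : SecondCountableTopology S) (_ : CompleteSpace S) (ρ : Measure S),
        IsProbabilityMeasure ρ ∧ IsMVb ρ r V (sliceMassBound H V θ) ∧
          Tendsto (fun k ↦ gromovW1 (μ (φ k)) ρ) atTop (𝓝 0) :=
  haveI : ∀ i, SecondCountableTopology ((𝒴 i).Slice (t i)) := fun _ ↦
    UniformSpace.secondCountable_of_separable _
  IsMVb.exists_tendsto_subseq (X := fun i ↦ (𝒴 i).Slice (t i)) μ hr hV0
    (fun ε _ _ ↦ sliceMassBound_ne_zero H V θ ε) (fun ε ↦ sliceMassBound_le_one H V θ ε) h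

end MetricFlow

end Literature.Geometry.Riemannian

end
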